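import Summits.Ventures.Crystal3D.TopCut.X2SOSExpand
import HarnessLib

/-!
# X2 cap certificates by sum-of-squares identities, Ia: column splitting of pole blocks

Venture `Crystal3D` (cell `pub-crystal3d`, phase 2; seat p2). A purely structural addendum to
`TopCut/X2SOSExpand.lean`: the pole expansions `polePval` / `poleSval` of ONE pole block are additive
in the block's COLUMN list, so a kernel chunk check (`pieceOK`, one `decide +kernel` per chunk) may
split a large block (at `(d, d_X) = (12, 12)` the block `k = 0` has 26 columns of degree-12 integer
polynomials and its pair expansion exceeds the kernel memory ceiling of the farm nodes in one piece)
into column groups and MERGE the resulting chunk validities back to the block of record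
(`polePChunkVal_mergeCols`, `poleSChunkVal_mergeCols`). Nothing else changes downstream
(`polePValid_of_chunkVal` still closes against the certificate's block list).
HONEST FRAMING: evaluation lemmas only [folklore]; NO certificate is asserted here.
-/

noncomputable section

open Literature.Geometry.DiscreteGeometry Literature.Geometry.DiscreteGeometry.PolyCert
open Literature.Geometry.DiscreteGeometry.PolyCert.SPoly
open Summit.Ventures.PackingBounds.ThreePointCert
open Summit.Ventures.Crystal3D.CapSOS Summit.Ventures.Crystal3D.CapX2

namespace Summit.Ventures.Crystal3D.X2SOS

/-- The pole pair value of one block is additive in its column list. [folklore] -/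
theorem polePval_cols_append (k s : ℕ) (c₁ c₂ : List (List ℤ × List ℤ)) (u v t : ℝ) :
    polePval [⟨k, s, c₁ ++ c₂⟩] u v t = polePval [⟨k, s, c₁⟩, ⟨k, s, c₂⟩] u v t := by
  simp only [polePval, List.map_cons, List.map_nil, List.sum_cons, List.sum_nil, List.map_append,
    List.sum_append]
  ring

/-- The triple value of one block is additive in its column list. [folklore] -/
theorem poleSval_cols_append (k s : ℕ) (c₁ c₂ : List (List ℤ × List ℤ)) (u v t : ℝ) :
    poleSval [⟨k, s, c₁ ++ c₂⟩] u v t = poleSval [⟨k, s, c₁⟩, ⟨k, s, c₂⟩] u v t := by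
  simp only [poleSval, List.map_cons, List.map_nil, List.sum_cons, List.sum_nil, List.map_append,
    List.sum_append]
  ring

/-- A pole-pair chunk validity over a block split into two column groups is a chunk validity over
the merged block. [folklore] -/
theorem polePChunkVal_mergeCols (k s : ℕ) (c₁ c₂ : List (List ℤ × List ℤ)) (D0 D1 : SPoly)
    (h : PolePChunkVal [⟨k, s, c₁⟩, ⟨k, s, c₂⟩] D0 D1) :
    PolePChunkVal [⟨k, s, c₁ ++ c₂⟩] D0 D1 := by
  intro u v t hu hv ht
  rw [h u v t hu hv ht, polePval_cols_append]

/-- A triple chunk validity over a block split into two column groups is a chunk validity over the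
merged block. [folklore] -/
theorem poleSChunkVal_mergeCols (k s : ℕ) (c₁ c₂ : List (List ℤ × List ℤ)) (D0 D1 : SPoly)
    (h : PoleSChunkVal [⟨k, s, c₁⟩, ⟨k, s, c₂⟩] D0 D1) :
    PoleSChunkVal [⟨k, s, c₁ ++ c₂⟩] D0 D1 := by
  intro u v t hu hv ht
  rw [h u v t hu hv ht, poleSval_cols_append]

/-- Chunk validities over block lists that agree as lists transfer (used to fold column-split chunk
chains back onto the certificate's block list by a `decide` on the lists). [folklore] -/
theorem polePChunkVal_congr (bs bs' : List PoleBlk) (D0 D1 : SPoly) (hbs : bs' = bs)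
    (h : PolePChunkVal bs' D0 D1) : PolePChunkVal bs D0 D1 := hbs ▸ h

/-- Triple version of `polePChunkVal_congr`. [folklore] -/
theorem poleSChunkVal_congr (bs bs' : List PoleBlk) (D0 D1 : SPoly) (hbs : bs' = bs)
    (h : PoleSChunkVal bs' D0 D1) : PoleSChunkVal bs D0 D1 := hbs ▸ h

end Summit.Ventures.Crystal3D.X2SOS

end
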